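import Literature.Probability.LatticeModels.FieldCurrentsTransport
import Literature.Probability.LatticeModels.IsingTransport
import HarnessLib

/-!
# The mean size of the ghost-avoiding cluster is at least `χ²` (Aizenman–Fernández 1986, Lemma 5.3)

Topic `Probability/LatticeModels`, namespace `Literature.Probability.LatticeModels`. Sequel of
`MeanFieldDifferentialInequality` (conditioning on `𝒮_g`, the weights `W(S') = dctW`, Claim 2),
`FieldCurrentsTransport` (translation invariance of `W` on the torus) and `IsingTransport`.

For the Ising model in a field (`β, h ≥ 0`, tree parametrisation) Aizenman–Fernández's quantity

  `T(0,u,x) = Z⁻² ∑_{∂n₁ = {0}Δ{x}, ∂n₂ = ∅} w w 𝟙[0 ↮ g] 𝟙[0 ↔ u]`      ((5.44), p. 438)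

is the weight of the pairs of currents with sources `{0,x}` whose cluster of `0` avoids the ghost
and contains `u`; `∑_{u,x} T(0,u,x)` is the mean size of that cluster under the measure of total
mass `χ = ∑_x ⟨σ₀;σ_x⟩`. **Lemma 5.3** ((5.11)/(5.48), p. 427 and p. 439): on a translation-invariant
(periodic) system, `∑_{u,x} T(0,u,x) ≥ χ²`. Proof as printed: switch the sources `{0,u}` into the
second current, condition on the cluster `C(h)` of the ghost — inside its complement `S'` the two
currents are zero-field currents with sources `{x,u}` and `{0,u}` ((5.1): weights
`⟨σ_xσ_u⟩_{S',0} ⟨σ₀σ_u⟩_{S',0} W(S')`) — move the shared point to `0` by translation invariance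
((5.12)), and apply Schwarz's inequality in `L²(dE)` together with (5.3),
`Z⁻² ∑_{S' ∋ 0,y} ⟨σ₀σ_y⟩_{S',0} W(S') = ⟨σ₀;σ_y⟩`.

## What is proved here

* Part A (general `G`, `Λ`): the switching step `currentPairSum_notConn_conn_eq_pair_pair`
  (`∑_{({0}Δ{x})*,∅} w w 𝟙[0 ↮ g] 𝟙[0 ↔ u] = ∑_{({x}Δ{u})*, ({0}Δ{u})*} w w 𝟙[0 ↮ g]`), the
  two-pair Claim 2 `currentPairSum_pair_pair_clusterCompl_eq` and the decomposition over `𝒮_g`,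
  `toReal_currentPairSum_pair_pair_notConn_eq_sum`:
  `Z⁻²∑_{({x}Δ{u})*,({0}Δ{u})*} w w 𝟙[0 ↮ g] = Z⁻² ∑_{S' ∋ 0,x,u} ⟨σ_xσ_u⟩_{S',0}⟨σ₀σ_u⟩_{S',0} W(S')`.
* Part B (the torus `(ℤ/Lℤ)^d`, `Λ = univ`): the translation-averaging step
  `sum_dctW_mul_pair_pair_eq_sum_sq` and **Lemma 5.3**, `afClusterSize_ge_susc_sq`:
  `(∑_y ⟨σ₀;σ_y⟩)² ≤ ∑_{x,u} T(0,u,x)` for the periodic Ising model in a field.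

## References

* M. Aizenman, R. Fernández, J. Stat. Phys. **44** (1986) 393–454, §5.1: Lemma 5.1 (5.1)–(5.3),
  Lemma 5.3 (5.11)–(5.12), p. 427; §5.2, (5.44), (5.48), pp. 438–439 [AizenmanFernandezJSP1986]
  (held: author copy `paper:url-b8cebc3f44bb`).
* H. Duminil-Copin, V. Tassion, CMP **343** (2016) 725, proof of Lemma 2.6, Claim 2
  (arXiv:1502.03050 numbering) [DuminilCopinTassionCMP2016].

## Mathlib

`Finset.sum_mul_sq_le_sq_mul_sq` (Cauchy–Schwarz), `Equiv.sum_comp`, `Equiv.finsetCongr`,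
`Finset.sum_comm`, `ENNReal.toReal_sum/mul/ofReal`.
-/

noncomputable section

open Finset MeasureTheory
open scoped symmDiff ENNReal

namespace Literature.Probability.LatticeModels

variable {V : Type*} [DecidableEq V]

/-! ## Part A. Switching and conditioning on the cluster of the ghost -/

section General

variable {G : SimpleGraph V} [G.LocallyFinite] {Λ : Finset V}

local notation "Gg" => ghostGraph G Λ
local notation "Λg" => Finset.insertNone Λ
local notation "Eg" => edgesIn (ghostGraph G Λ) (Finset.insertNone Λ)
local notation "Zg[" θ ", " X "]" =>
  gcurrentZ (ghostGraph G Λ) (Finset.insertNone Λ) θ (edgesIn (ghostGraph G Λ) (Finset.insertNone Λ)) X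
local notation "Conn[" m ", " u ", " v "]" =>
  CConn (ghostGraph G Λ) (Finset.insertNone Λ) m (edgesIn (ghostGraph G Λ) (Finset.insertNone Λ)) u v
local notation "∂g" => csources (ghostGraph G Λ) (Finset.insertNone Λ)
local notation "𝒮[" m ", " b "]" => clusterCompl (ghostGraph G Λ) (Finset.insertNone Λ) m b

/-- **Switching `{0,u}` into the second current**: for `θ ≥ 0`,
`∑_{∂n₁=({o}Δ{x})*, ∂n₂=∅} w w 𝟙[o ↮ g] 𝟙[o ↔ u] = ∑_{∂n₁=({x}Δ{u})*, ∂n₂=({o}Δ{u})*} w w 𝟙[o ↮ g]`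
(Aizenman–Fernández 1986, proof of Lemma 5.3: the left-hand side is `Z² T(o,u,x)`, (5.44)). [cite: AizenmanFernandezJSP1986, §5.1, Lemma 5.3, eq. (5.11), p. 427, and §5.2, eq. (5.44), p. 438] -/
theorem currentPairSum_notConn_conn_eq_pair_pair {θ : Sym2 (Option V) → ℝ} (hθ : ∀ e, 0 ≤ θ e) (o x u : V) :
    currentPairSum G Λ θ (starSet ({o} ∆ {x})) ∅
        (fun m => ind (¬Conn[m, some o, none]) * ind (Conn[m, some o, some u])) =
      currentPairSum G Λ θ (starSet ({x} ∆ {u})) (starSet ({o} ∆ {u})) (fun m => ind (¬Conn[m, some o, none])) := by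
  rw [starSet_pair, starSet_pair, starSet_pair]
  have hA : ({some x} ∆ {some u} : Finset (Option V)) = ({some o} ∆ {some x}) ∆ ({some o} ∆ {some u}) := by
    ext v
    simp only [mem_symmDiff, mem_singleton]
    tauto
  rw [hA, currentPairSum_switching hθ]

/-- If `o ∈ S'` but `x ∉ S'` or `u ∉ S'`, the event `𝒮_g = S'` is incompatible with the sources
`({x}Δ{u})*, ({o}Δ{u})*` (they force `o ↔ u ↔ x`). [folklore] -/
theorem currentPairSum_pair_pair_clusterCompl_eq_zero (θ : Sym2 (Option V) → ℝ) {S' : Finset V} {o x u : V}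
    (ho : o ∈ S') (hxu : x ∉ S' ∨ u ∉ S') (hx : x ∈ Λ) (hu : u ∈ Λ) :
    currentPairSum G Λ θ (starSet ({x} ∆ {u})) (starSet ({o} ∆ {u}))
        (fun m => ind (𝒮[m, none] = S'.map Function.Embedding.some)) = 0 := by
  have h0 : currentPairSum G Λ θ (starSet ({x} ∆ {u})) (starSet ({o} ∆ {u})) (fun _ => 0) = 0 := by
    unfold currentPairSum; simp
  rw [← h0]
  refine currentPairSum_congr fun n₁ n₂ h1 h2 => ind_of_false fun hS => ?_
  have hmem : ∀ {t : V}, t ∈ Λ → ((some t : Option V) ∈ 𝒮[n₁ + n₂, none] ↔ t ∈ S') := fun {t} ht => by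
    rw [hS]
    constructor
    · intro h
      obtain ⟨t', ht', htt⟩ := mem_map.1 h
      exact (Option.some_injective _ htt) ▸ ht'
    · exact fun h => mem_map_of_mem _ h
  have hoΛ : o ∈ Λ := by
    have : (some o : Option V) ∈ 𝒮[n₁ + n₂, none] := hS ▸ mem_map_of_mem _ ho
    exact Finset.some_mem_insertNone.1 (clusterCompl_subset _ _ this)
  -- `o ↔ u` in `n₂`, `x ↔ u` in `n₁`
  have hou : Conn[n₁ + n₂, some o, some u] := by
    by_cases h : o = u
    · subst h; exact Relation.ReflTransGen.refl
    · have hsrc : ∂g n₂ = ({some o} ∆ {some u} : Finset (Option V)) := by rw [h2, starSet_pair]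
      exact (cconn_of_csources_eq (fun h' => h (Option.some_injective _ h')) hsrc).mono fun e => Nat.le_add_left _ _
  have hxu' : Conn[n₁ + n₂, some x, some u] := by
    by_cases h : x = u
    · subst h; exact Relation.ReflTransGen.refl
    · have hsrc : ∂g n₁ = ({some x} ∆ {some u} : Finset (Option V)) := by rw [h1, starSet_pair]
      exact (cconn_of_csources_eq (fun h' => h (Option.some_injective _ h')) hsrc).mono fun e => Nat.le_add_right _ _
  have hog : ¬Conn[n₁ + n₂, none, some o] := (mem_clusterCompl.1 ((hmem hoΛ).2 ho)).2
  rcases hxu with hxS | huS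
  · have hxg : Conn[n₁ + n₂, none, some x] := by
      have := (hmem hx).not.2 hxS
      rwa [some_mem_clusterCompl_iff hx, not_not] at this
    exact hog (hxg.trans (hxu'.trans hou.symm))
  · have hug : Conn[n₁ + n₂, none, some u] := by
      have := (hmem hu).not.2 huS
      rwa [some_mem_clusterCompl_iff hu, not_not] at this
    exact hog (hug.trans hou.symm)

/-- **Claim 2 for two pairs of sources** (Aizenman–Fernández 1986, Lemma 5.1, (5.1): conditioning
on the cluster `C(h)` of the ghost): for `S' ⊆ Λ`, `a, b, c, e ∈ S'`, `β ≥ 0`,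
`∑_{∂n₁=({a}Δ{b})*, ∂n₂=({c}Δ{e})*} w w 𝟙[𝒮_g = S'] = ⟨σ_aσ_b⟩_{S',β,0} ⟨σ_cσ_e⟩_{S',β,0} W(S')`
(the currents inside `S'` see no field). [cite: AizenmanFernandezJSP1986, §5.1, Lemma 5.1, eq. (5.1), p. 425] [cite: DuminilCopinTassionCMP2016, proof of Lemma 2.6, Claim 2 (arXiv:1502.03050 numbering)] -/
theorem currentPairSum_two_pairs_clusterCompl_eq {β h : ℝ} (hβ : 0 ≤ β) (hh : 0 ≤ h) {S' : Finset V}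
    (hS' : S' ⊆ Λ) {a b c e : V} (ha : a ∈ S') (hb : b ∈ S') (hc : c ∈ S') (he : e ∈ S') :
    currentPairSum G Λ (ghostCoupling β (β * h)) (starSet ({a} ∆ {b})) (starSet ({c} ∆ {e}))
        (fun m => ind (𝒮[m, none] = S'.map Function.Embedding.some)) =
      ENNReal.ofReal (isingCorr G S' β 0 .free ({a} ∆ {b})) * ENNReal.ofReal (isingCorr G S' β 0 .free ({c} ∆ {e})) *
        dctW G Λ (ghostCoupling β (β * h)) S' := by
  set θ : Sym2 (Option V) → ℝ := ghostCoupling β (β * h) with hθdef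
  have hθ : ∀ e : Sym2 (Option V), 0 ≤ θ e := ghostCoupling_nonneg hβ (mul_nonneg hβ hh)
  set S := S'.map Function.Embedding.some with hSdef
  have hSΛ : S ⊆ Λg := fun v hv => by
    obtain ⟨t, ht, rfl⟩ := mem_map.1 hv
    exact Finset.some_mem_insertNone.2 (hS' ht)
  have hbS : (none : Option V) ∈ Λg \ S :=
    mem_sdiff.2 ⟨Finset.mem_insertNone.2 (by simp), fun h => by
      obtain ⟨t, -, ht⟩ := mem_map.1 h; exact Option.some_ne_none t ht⟩
  have hmemS : ∀ {a' b' : V}, a' ∈ S' → b' ∈ S' → ∀ v ∈ starSet ({a'} ∆ {b'}), v ∈ S := by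
    intro a' b' ha' hb' v hv
    rw [starSet_pair, mem_symmDiff, mem_singleton, mem_singleton] at hv
    rcases hv with ⟨rfl, -⟩ | ⟨rfl, -⟩
    · exact mem_map_of_mem _ ha'
    · exact mem_map_of_mem _ hb'
  have hX : (starSet ({a} ∆ {b})).filter (· ∈ S) = starSet ({a} ∆ {b}) := filter_true_of_mem (hmemS ha hb)
  have hX' : (starSet ({a} ∆ {b})).filter (· ∉ S) = ∅ := filter_false_of_mem fun v hv => not_not.2 (hmemS ha hb v hv)
  have hY : (starSet ({c} ∆ {e})).filter (· ∈ S) = starSet ({c} ∆ {e}) := filter_true_of_mem (hmemS hc he)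
  have hY' : (starSet ({c} ∆ {e})).filter (· ∉ S) = ∅ := filter_false_of_mem fun v hv => not_not.2 (hmemS hc he v hv)
  -- zero-field representations inside `S'`
  have hE : edgesIn Gg S = (edgesIn G S').map liftEdge := edgesIn_ghostGraph_map_some S'
  have hrep : ∀ {a' b' : V}, a' ∈ S' → b' ∈ S' →
      gcurrentZ Gg Λg θ (edgesIn Gg S) (starSet ({a'} ∆ {b'})) =
        ENNReal.ofReal (isingCorr G S' β 0 .free ({a'} ∆ {b'})) * gcurrentZ Gg Λg θ (edgesIn Gg S) ∅ := by
    intro a' b' ha' hb'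
    have hab : ({a'} ∆ {b'} : Finset V) ⊆ S' :=
      symmDiff_le_sup.trans (sup_le (singleton_subset_iff.2 ha') (singleton_subset_iff.2 hb'))
    have h0 := isingCorr_free_zero_eq_gcurrentZ_div (G := G) (Λ := Λ) hS' hβ (β * h) hab (even_card_singleton_symmDiff a' b')
    rw [← starSet_of_even (even_card_singleton_symmDiff a' b'), ← hE] at h0
    have hEsub : edgesIn Gg S ⊆ Eg := by
      rw [hE]; exact (map_liftEdge_subset_edgesIn hS').trans (edgesIn_insertNone_mono hS')
    have hfin : ∀ X, gcurrentZ Gg Λg θ (edgesIn Gg S) X ≠ ∞ := fun X => gcurrentZ_ne_top hθ hEsub X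
    have hpos : 0 < (gcurrentZ Gg Λg θ (edgesIn Gg S) ∅).toReal :=
      ENNReal.toReal_pos (ne_of_gt (lt_of_lt_of_le zero_lt_one (one_le_gcurrentZ_empty θ _))) (hfin ∅)
    have hne : gcurrentZ Gg Λg θ (edgesIn Gg S) ∅ ≠ 0 := fun h0' => by
      rw [h0', ENNReal.toReal_zero] at hpos; exact lt_irrefl _ hpos
    rw [h0, ENNReal.ofReal_div_of_pos hpos, ENNReal.ofReal_toReal (hfin _), ENNReal.ofReal_toReal (hfin _),
      ENNReal.div_mul_cancel hne (hfin _)]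
  unfold dctW
  rw [← hSdef, currentPairSum_clusterCompl_eq θ hSΛ hbS, currentPairSum_clusterCompl_eq θ hSΛ hbS, hX, hX', hY, hY',
    hrep ha hb, hrep hc he]
  simp only [filter_empty]
  ring

/-- The instance of `currentPairSum_two_pairs_clusterCompl_eq` with a shared point:
`∑_{∂n₁=({x}Δ{u})*, ∂n₂=({o}Δ{u})*} w w 𝟙[𝒮_g = S'] = ⟨σ_xσ_u⟩_{S',β,0} ⟨σ_oσ_u⟩_{S',β,0} W(S')`. [cite: AizenmanFernandezJSP1986, §5.1, Lemma 5.1, eq. (5.1), p. 425] -/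
theorem currentPairSum_pair_pair_clusterCompl_eq {β h : ℝ} (hβ : 0 ≤ β) (hh : 0 ≤ h) {S' : Finset V}
    (hS' : S' ⊆ Λ) {o x u : V} (ho : o ∈ S') (hx : x ∈ S') (hu : u ∈ S') :
    currentPairSum G Λ (ghostCoupling β (β * h)) (starSet ({x} ∆ {u})) (starSet ({o} ∆ {u}))
        (fun m => ind (𝒮[m, none] = S'.map Function.Embedding.some)) =
      ENNReal.ofReal (isingCorr G S' β 0 .free ({x} ∆ {u})) * ENNReal.ofReal (isingCorr G S' β 0 .free ({o} ∆ {u})) *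
        dctW G Λ (ghostCoupling β (β * h)) S' :=
  currentPairSum_two_pairs_clusterCompl_eq hβ hh hS' hx hu ho hu

/-- Decomposition over `𝒮_g`: `𝟙[o ↮ g] = ∑_{S' ∋ o} 𝟙[𝒮_g = S']` inside a two-pair sum. [cite: AizenmanFernandezJSP1986, §5.1, Lemma 5.1, eq. (5.1), p. 425] -/
theorem currentPairSum_pair_pair_notConn_eq_sum (θ : Sym2 (Option V) → ℝ) {o : V} (ho : o ∈ Λ) (x u : V) :
    currentPairSum G Λ θ (starSet ({x} ∆ {u})) (starSet ({o} ∆ {u})) (fun m => ind (¬Conn[m, some o, none])) =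
      ∑ S' ∈ Λ.powerset.filter (fun S' => o ∈ S'),
        currentPairSum G Λ θ (starSet ({x} ∆ {u})) (starSet ({o} ∆ {u}))
          (fun m => ind (𝒮[m, none] = S'.map Function.Embedding.some)) := by
  rw [← currentPairSum_finset_sum]
  refine currentPairSum_congr fun n₁ n₂ _ _ => ?_
  rw [sum_ind_clusterCompl_none, mem_eraseNone_clusterCompl_none_iff ho]

/-- **`Z² T(o,u,x)` conditioned on the cluster of the ghost**, in real numbers: for `o, x, u ∈ Λ`,
`β, h ≥ 0`,
`(∑_{({x}Δ{u})*,({o}Δ{u})*} w w 𝟙[o ↮ g]) = ∑_{S' ∋ o, x, u} ⟨σ_xσ_u⟩_{S',0} ⟨σ_oσ_u⟩_{S',0} W(S')`. [cite: AizenmanFernandezJSP1986, §5.1, proof of Lemma 5.3, p. 427] -/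
theorem toReal_currentPairSum_pair_pair_notConn_eq_sum {β h : ℝ} (hβ : 0 ≤ β) (hh : 0 ≤ h) {o x u : V}
    (ho : o ∈ Λ) (hx : x ∈ Λ) (hu : u ∈ Λ) :
    (currentPairSum G Λ (ghostCoupling β (β * h)) (starSet ({x} ∆ {u})) (starSet ({o} ∆ {u}))
        (fun m => ind (¬Conn[m, some o, none]))).toReal =
      ∑ S' ∈ Λ.powerset.filter (fun S' => o ∈ S' ∧ x ∈ S' ∧ u ∈ S'),
        isingCorr G S' β 0 .free ({x} ∆ {u}) * isingCorr G S' β 0 .free ({o} ∆ {u}) *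
          (dctW G Λ (ghostCoupling β (β * h)) S').toReal := by
  set θ : Sym2 (Option V) → ℝ := ghostCoupling β (β * h) with hθdef
  have hθ : ∀ e : Sym2 (Option V), 0 ≤ θ e := ghostCoupling_nonneg hβ (mul_nonneg hβ hh)
  rw [currentPairSum_pair_pair_notConn_eq_sum θ ho x u]
  -- drop the vanishing terms
  have hsplit : ∑ S' ∈ Λ.powerset.filter (fun S' => o ∈ S'),
      currentPairSum G Λ θ (starSet ({x} ∆ {u})) (starSet ({o} ∆ {u}))
        (fun m => ind (𝒮[m, none] = S'.map Function.Embedding.some)) =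
      ∑ S' ∈ Λ.powerset.filter (fun S' => o ∈ S' ∧ x ∈ S' ∧ u ∈ S'),
        currentPairSum G Λ θ (starSet ({x} ∆ {u})) (starSet ({o} ∆ {u}))
          (fun m => ind (𝒮[m, none] = S'.map Function.Embedding.some)) := by
    rw [← sum_filter_add_sum_filter_not (Λ.powerset.filter (fun S' => o ∈ S')) (fun S' => x ∈ S' ∧ u ∈ S')]
    have hzero : ∑ S' ∈ (Λ.powerset.filter (fun S' => o ∈ S')).filter (fun S' => ¬(x ∈ S' ∧ u ∈ S')),
        currentPairSum G Λ θ (starSet ({x} ∆ {u})) (starSet ({o} ∆ {u}))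
          (fun m => ind (𝒮[m, none] = S'.map Function.Embedding.some)) = 0 :=
      sum_eq_zero fun S' hS' => by
        rw [mem_filter, mem_filter] at hS'
        exact currentPairSum_pair_pair_clusterCompl_eq_zero θ hS'.1.2 (not_and_or.1 hS'.2) hx hu
    rw [hzero, add_zero, filter_filter]
  rw [hsplit, ENNReal.toReal_sum (fun S' _ => currentPairSum_ne_top hθ _ _ fun _ => ind_le_one _)]
  refine sum_congr rfl fun S' hS' => ?_
  rw [mem_filter, mem_powerset] at hS'
  rw [currentPairSum_pair_pair_clusterCompl_eq hβ hh hS'.1 hS'.2.1 hS'.2.2.1 hS'.2.2.2, ENNReal.toReal_mul,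
    ENNReal.toReal_mul,
    ENNReal.toReal_ofReal (GKSInequalities.gks_one_holds G hβ le_rfl (Or.inl rfl)
      (symmDiff_le_sup.trans (sup_le (singleton_subset_iff.2 hS'.2.2.1) (singleton_subset_iff.2 hS'.2.2.2)))),
    ENNReal.toReal_ofReal (GKSInequalities.gks_one_holds G hβ le_rfl (Or.inl rfl)
      (symmDiff_le_sup.trans (sup_le (singleton_subset_iff.2 hS'.2.1) (singleton_subset_iff.2 hS'.2.2.2))))]

end General

/-! ## Part B. The torus: translation averaging, Schwarz, and Lemma 5.3 -/

section Torus

variable {d L : ℕ} [NeZero L]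

local notation "TG" => torusGraph d L
local notation "TV" => TorusSite d L

/-- Zero-field two-point function of the free Ising model on a sub-volume `S'` of the torus:
`G_{S'}(a,b) = ⟨σ_{{a}Δ{b}}⟩^∅_{S';β,0}`. [cite: FriedliVelenik2017, §3.2] -/
def subTwoPoint (β : ℝ) (S' : Finset TV) (a b : TV) : ℝ :=
  isingCorr TG S' β 0 .free ({a} ∆ {b})

/-- `G_{S'}(a,b) = G_{S'}(b,a)`. [folklore] -/
theorem subTwoPoint_comm (β : ℝ) (S' : Finset TV) (a b : TV) : subTwoPoint β S' a b = subTwoPoint β S' b a := by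
  unfold subTwoPoint; rw [symmDiff_comm]

/-- `0 ≤ G_{S'}(a,b)` for `a, b ∈ S'`, `β ≥ 0` (GKS I). [cite: FriedliVelenik2017, Thm. 3.20, eq. (3.21)] -/
theorem subTwoPoint_nonneg {β : ℝ} (hβ : 0 ≤ β) {S' : Finset TV} {a b : TV} (ha : a ∈ S') (hb : b ∈ S') :
    0 ≤ subTwoPoint β S' a b :=
  GKSInequalities.gks_one_holds TG hβ le_rfl (Or.inl rfl)
    (symmDiff_le_sup.trans (sup_le (singleton_subset_iff.2 ha) (singleton_subset_iff.2 hb)))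

/-- **Translation covariance of the sub-volume two-point function**:
`G_{S'+a}(x+a, y+a) = G_{S'}(x, y)` (the free state only depends on the induced graph,
`isingCorr_free_map`). [cite: FriedliVelenik2017, §3.1 (periodic boundary condition)] -/
theorem subTwoPoint_map_add (β : ℝ) (S' : Finset TV) (a x y : TV) :
    subTwoPoint β (S'.map (Equiv.addRight a).toEmbedding) (x + a) (y + a) = subTwoPoint β S' x y := by
  unfold subTwoPoint
  have hmap : ({x + a} ∆ {y + a} : Finset TV) = ({x} ∆ {y} : Finset TV).map (Equiv.addRight a).toEmbedding := by
    rw [map_eq_image, image_symmDiff _ _ (Equiv.addRight a).toEmbedding.injective, image_singleton, image_singleton]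
    rfl
  rw [hmap]
  exact isingCorr_free_map (G := TG) (G' := TG) (Equiv.addRight a).toEmbedding
    (fun x _ y _ => torusGraph_adj_add_right a x y) β 0 _

/-- Zero-field susceptibility of the sub-volume at a point: `χ_{S'}(a) = ∑_{y ∈ S'} G_{S'}(a,y)`. [folklore] -/
def subSusc (β : ℝ) (S' : Finset TV) (a : TV) : ℝ := ∑ y ∈ S', subTwoPoint β S' a y

/-- `χ_{S'+a}(x+a) = χ_{S'}(x)`. [folklore] -/
theorem subSusc_map_add (β : ℝ) (S' : Finset TV) (a x : TV) :
    subSusc β (S'.map (Equiv.addRight a).toEmbedding) (x + a) = subSusc β S' x := by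
  unfold subSusc
  rw [sum_map]
  refine sum_congr rfl fun y _ => ?_
  exact subTwoPoint_map_add β S' a x y

/-- Exchange of a sum over points with a sum over the sets containing them. [folklore] -/
theorem sum_sum_filter_mem_eq (P : Finset (Finset TV)) (p : Finset TV → Prop) [DecidablePred p]
    (F : Finset TV → TV → ℝ) :
    ∑ y : TV, ∑ S' ∈ P.filter (fun S' => p S' ∧ y ∈ S'), F S' y = ∑ S' ∈ P.filter p, ∑ y ∈ S', F S' y := by
  classical
  have h1 : ∀ y : TV, ∑ S' ∈ P.filter (fun S' => p S' ∧ y ∈ S'), F S' y =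
      ∑ S' ∈ P, if p S' ∧ y ∈ S' then F S' y else 0 := fun y => sum_filter _ _
  simp_rw [h1]
  rw [sum_comm, sum_filter]
  refine sum_congr rfl fun S' _ => ?_
  by_cases hp : p S'
  · simp only [hp, true_and, if_true]
    rw [Finset.sum_ite_mem, univ_inter]
  · simp only [hp, false_and, if_false, sum_const_zero]

/-- Two-point version of `sum_sum_filter_mem_eq`. [folklore] -/
theorem sum_sum_sum_filter_mem_eq (P : Finset (Finset TV)) (p : Finset TV → Prop) [DecidablePred p]
    (F : Finset TV → TV → TV → ℝ) :
    ∑ x : TV, ∑ u : TV, ∑ S' ∈ P.filter (fun S' => p S' ∧ x ∈ S' ∧ u ∈ S'), F S' x u =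
      ∑ S' ∈ P.filter p, ∑ u ∈ S', ∑ x ∈ S', F S' x u := by
  classical
  have hinner : ∀ x : TV, ∑ u : TV, ∑ S' ∈ P.filter (fun S' => p S' ∧ x ∈ S' ∧ u ∈ S'), F S' x u =
      ∑ S' ∈ P.filter (fun S' => p S' ∧ x ∈ S'), ∑ u ∈ S', F S' x u := by
    intro x
    have := sum_sum_filter_mem_eq P (fun S' => p S' ∧ x ∈ S') (fun S' u => F S' x u)
    refine Eq.trans (sum_congr rfl fun u _ => sum_congr (filter_congr fun S' _ => by tauto) fun _ _ => rfl) this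
  simp_rw [hinner]
  rw [sum_sum_filter_mem_eq P p (fun S' x => ∑ u ∈ S', F S' x u)]
  exact sum_congr rfl fun S' _ => sum_comm

/-- **The translation-averaging step** (Aizenman–Fernández 1986, (5.12): "`∑_{y,z} f(x,y,z) = ∑_{y,z} f(y,x,z)`"
for translation-invariant `f`): with `W` translation invariant (`dctW_torus_add`),
`∑_{S' ∋ 0} W(S') ∑_{u ∈ S'} G_{S'}(0,u) χ_{S'}(u) = ∑_{S' ∋ 0} W(S') χ_{S'}(0)²`
(substitute `S' = T + u`: `G_{T+u}(0,u) = G_T(-u,0)`, `χ_{T+u}(u) = χ_T(0)`). [cite: AizenmanFernandezJSP1986, §5.1, eq. (5.12) and proof of Lemma 5.3, p. 427] -/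
theorem sum_dctW_mul_pair_pair_eq_sum_sq (β k : ℝ) :
    ∑ S' ∈ (Finset.univ : Finset TV).powerset.filter (fun S' => (0 : TV) ∈ S'),
        (dctW TG Finset.univ (ghostCoupling β k) S').toReal *
          ∑ u ∈ S', subTwoPoint β S' 0 u * subSusc β S' u =
      ∑ S' ∈ (Finset.univ : Finset TV).powerset.filter (fun S' => (0 : TV) ∈ S'),
        (dctW TG Finset.univ (ghostCoupling β k) S').toReal * subSusc β S' 0 ^ 2 := by
  classical
  set W : Finset TV → ℝ := fun S' => (dctW TG Finset.univ (ghostCoupling β k) S').toReal with hW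
  have hWinv : ∀ (T : Finset TV) (a : TV), W (T.map (Equiv.addRight a).toEmbedding) = W T := fun T a => by
    simp only [hW, dctW_torus_add]
  -- both sides as sums over all finsets
  set Φ : TV → Finset TV → ℝ := fun u S' =>
    if (0 : TV) ∈ S' ∧ u ∈ S' then W S' * (subTwoPoint β S' 0 u * subSusc β S' u) else 0 with hΦ
  set Ψ : TV → Finset TV → ℝ := fun b T =>
    if (0 : TV) ∈ T ∧ b ∈ T then W T * (subTwoPoint β T b 0 * subSusc β T 0) else 0 with hΨ
  have hL : ∑ S' ∈ (Finset.univ : Finset TV).powerset.filter (fun S' => (0 : TV) ∈ S'),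
        W S' * ∑ u ∈ S', subTwoPoint β S' 0 u * subSusc β S' u = ∑ u : TV, ∑ S' : Finset TV, Φ u S' := by
    rw [sum_comm, powerset_univ, sum_filter]
    refine sum_congr rfl fun S' _ => ?_
    by_cases h0 : (0 : TV) ∈ S'
    · rw [if_pos h0, mul_sum]
      simp only [hΦ, h0, true_and]
      rw [Finset.sum_ite_mem, univ_inter]
    · rw [if_neg h0]
      exact (sum_eq_zero fun u _ => by rw [hΦ]; exact if_neg fun h => h0 h.1).symm
  have hR : ∑ S' ∈ (Finset.univ : Finset TV).powerset.filter (fun S' => (0 : TV) ∈ S'),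
        W S' * subSusc β S' 0 ^ 2 = ∑ b : TV, ∑ T : Finset TV, Ψ b T := by
    rw [sum_comm, powerset_univ, sum_filter]
    refine sum_congr rfl fun T _ => ?_
    by_cases h0 : (0 : TV) ∈ T
    · rw [if_pos h0]
      simp only [hΨ, h0, true_and]
      rw [Finset.sum_ite_mem, univ_inter, ← Finset.mul_sum, ← Finset.sum_mul]
      congr 1
      rw [sq]
      congr 1
      unfold subSusc
      exact sum_congr rfl fun b _ => subTwoPoint_comm β T 0 b
    · rw [if_neg h0]
      exact (sum_eq_zero fun u _ => by rw [hΨ]; exact if_neg fun h => h0 h.1).symm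
  rw [hL, hR]
  -- translate by `-u` inside, then reflect `u ↦ -u`
  have htrans : ∀ u : TV, ∑ S' : Finset TV, Φ u S' = ∑ T : Finset TV, Ψ (-u) T := by
    intro u
    rw [← Equiv.sum_comp (Equiv.addRight u).finsetCongr (fun S' => Φ u S')]
    refine sum_congr rfl fun T _ => ?_
    simp only [Equiv.finsetCongr_apply, hΦ, hΨ]
    have hm0 : (0 : TV) ∈ T.map (Equiv.addRight u).toEmbedding ↔ -u ∈ T := by
      rw [Finset.mem_map_equiv, Equiv.addRight_symm]
      simp only [Equiv.coe_addRight, zero_add]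
    have hmu : u ∈ T.map (Equiv.addRight u).toEmbedding ↔ (0 : TV) ∈ T := by
      rw [Finset.mem_map_equiv, Equiv.addRight_symm]
      simp only [Equiv.coe_addRight, add_neg_cancel]
    have hG : subTwoPoint β (T.map (Equiv.addRight u).toEmbedding) 0 u = subTwoPoint β T (-u) 0 := by
      have := subTwoPoint_map_add β T u (-u) 0
      rwa [neg_add_cancel, zero_add] at this
    have hχ : subSusc β (T.map (Equiv.addRight u).toEmbedding) u = subSusc β T 0 := by
      have := subSusc_map_add β T u 0
      rwa [zero_add] at this
    simp only [hm0, hmu, hWinv, hG, hχ]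
    by_cases h : -u ∈ T ∧ (0 : TV) ∈ T
    · rw [if_pos h, if_pos ⟨h.2, h.1⟩]
    · rw [if_neg h, if_neg (fun h' => h ⟨h'.2, h'.1⟩)]
  simp_rw [htrans]
  exact Equiv.sum_comp (Equiv.neg TV) (fun b => ∑ T : Finset TV, Ψ b T)

/-- **Aizenman–Fernández 1986, Lemma 5.3** ((5.11), (5.48)) on the discrete torus: for the
periodic Ising model in a field (`β, h ≥ 0`, tree parametrisation; free = periodic boundary
condition on the whole torus),
`(∑_y ⟨σ₀;σ_y⟩)² ≤ ∑_{x,u} T(0,u,x)`, `T(0,u,x) = Z⁻² ∑_{∂n₁={0}Δ{x},∂n₂=∅} w w 𝟙[0 ↮ g] 𝟙[0 ↔ u]`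
(switching, conditioning on the cluster of the ghost, translation averaging (5.12), Schwarz in
`L²(dE)` and (5.3); `∑_{S' ∋ 0} W(S')/Z² = 1 - ⟨σ₀⟩² ≤ 1`). [cite: AizenmanFernandezJSP1986, §5.1, Lemma 5.3, eqs. (5.11)–(5.12), p. 427, and §5.2, eq. (5.48), p. 439] -/
theorem afClusterSize_ge_susc_sq {β h : ℝ} (hβ : 0 ≤ β) (hh : 0 ≤ h) :
    (∑ y : TV, (isingCorr TG Finset.univ β h .free ({(0 : TV)} ∆ {y}) -
        isingCorr TG Finset.univ β h .free {(0 : TV)} * isingCorr TG Finset.univ β h .free {y})) ^ 2 ≤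
      ∑ x : TV, ∑ u : TV,
        (currentPairSum TG Finset.univ (ghostCoupling β (β * h)) (starSet ({(0 : TV)} ∆ {x})) ∅
            (fun m => ind (¬CConn (ghostGraph TG Finset.univ) (Finset.insertNone Finset.univ) m
                (edgesIn (ghostGraph TG Finset.univ) (Finset.insertNone Finset.univ)) (some 0) none) *
              ind (CConn (ghostGraph TG Finset.univ) (Finset.insertNone Finset.univ) m
                (edgesIn (ghostGraph TG Finset.univ) (Finset.insertNone Finset.univ)) (some 0) (some u)))).toReal /
          (gcurrentZ (ghostGraph TG Finset.univ) (Finset.insertNone Finset.univ) (ghostCoupling β (β * h))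
            (edgesIn (ghostGraph TG Finset.univ) (Finset.insertNone Finset.univ)) ∅).toReal ^ 2 := by
  classical
  set θ : Sym2 (Option TV) → ℝ := ghostCoupling β (β * h) with hθdef
  have hθ : ∀ e : Sym2 (Option TV), 0 ≤ θ e := ghostCoupling_nonneg hβ (mul_nonneg hβ hh)
  set Z : ℝ := (gcurrentZ (ghostGraph TG Finset.univ) (Finset.insertNone Finset.univ) θ
    (edgesIn (ghostGraph TG Finset.univ) (Finset.insertNone Finset.univ)) ∅).toReal with hZ
  have hZpos : 0 < Z := toReal_gcurrentZ_ghost_empty_pos (subset_refl _) hθ subset_rfl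
  set W : Finset TV → ℝ := fun S' => (dctW TG Finset.univ θ S').toReal with hW
  have hW0 : ∀ S', 0 ≤ W S' := fun S' => ENNReal.toReal_nonneg
  set P := (Finset.univ : Finset TV).powerset with hP
  have hmemu : ∀ t : TV, t ∈ (Finset.univ : Finset TV) := fun t => mem_univ t
  -- the right-hand side: switch, condition, exchange, translate
  have hRHS : ∑ x : TV, ∑ u : TV,
        (currentPairSum TG Finset.univ θ (starSet ({(0 : TV)} ∆ {x})) ∅
            (fun m => ind (¬CConn (ghostGraph TG Finset.univ) (Finset.insertNone Finset.univ) m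
                (edgesIn (ghostGraph TG Finset.univ) (Finset.insertNone Finset.univ)) (some 0) none) *
              ind (CConn (ghostGraph TG Finset.univ) (Finset.insertNone Finset.univ) m
                (edgesIn (ghostGraph TG Finset.univ) (Finset.insertNone Finset.univ)) (some 0) (some u)))).toReal / Z ^ 2 =
      (∑ S' ∈ P.filter (fun S' => (0 : TV) ∈ S'), W S' * subSusc β S' 0 ^ 2) / Z ^ 2 := by
    rw [← sum_dctW_mul_pair_pair_eq_sum_sq β (β * h)]
    simp_rw [← Finset.sum_div]
    congr 1
    have hterm : ∀ x u : TV, (currentPairSum TG Finset.univ θ (starSet ({(0 : TV)} ∆ {x})) ∅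
            (fun m => ind (¬CConn (ghostGraph TG Finset.univ) (Finset.insertNone Finset.univ) m
                (edgesIn (ghostGraph TG Finset.univ) (Finset.insertNone Finset.univ)) (some 0) none) *
              ind (CConn (ghostGraph TG Finset.univ) (Finset.insertNone Finset.univ) m
                (edgesIn (ghostGraph TG Finset.univ) (Finset.insertNone Finset.univ)) (some 0) (some u)))).toReal =
        ∑ S' ∈ P.filter (fun S' => (0 : TV) ∈ S' ∧ x ∈ S' ∧ u ∈ S'),
          subTwoPoint β S' x u * subTwoPoint β S' 0 u * W S' := by
      intro x u
      rw [currentPairSum_notConn_conn_eq_pair_pair hθ, toReal_currentPairSum_pair_pair_notConn_eq_sum hβ hh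
        (hmemu 0) (hmemu x) (hmemu u)]
      rfl
    simp_rw [hterm]
    rw [sum_sum_sum_filter_mem_eq P (fun S' => (0 : TV) ∈ S') (fun S' x u => subTwoPoint β S' x u * subTwoPoint β S' 0 u * W S')]
    refine sum_congr rfl fun S' _ => ?_
    rw [Finset.mul_sum]
    refine sum_congr rfl fun u _ => ?_
    unfold subSusc
    rw [Finset.mul_sum, Finset.mul_sum]
    refine sum_congr rfl fun x _ => ?_
    rw [subTwoPoint_comm β S' u x]
    ring
  -- the left-hand side: (5.3)
  have hLHS : ∑ y : TV, (isingCorr TG Finset.univ β h .free ({(0 : TV)} ∆ {y}) -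
        isingCorr TG Finset.univ β h .free {(0 : TV)} * isingCorr TG Finset.univ β h .free {y}) =
      (∑ S' ∈ P.filter (fun S' => (0 : TV) ∈ S'), W S' * subSusc β S' 0) / Z ^ 2 := by
    have h53 : ∀ y : TV, isingCorr TG Finset.univ β h .free ({(0 : TV)} ∆ {y}) -
        isingCorr TG Finset.univ β h .free {(0 : TV)} * isingCorr TG Finset.univ β h .free {y} =
        (∑ S' ∈ P.filter (fun S' => (0 : TV) ∈ S' ∧ y ∈ S'), subTwoPoint β S' 0 y * W S') / Z ^ 2 := fun y =>
      (sum_isingCorr_zero_mul_dctW_eq (G := TG) (Λ := Finset.univ) hβ hh (hmemu 0) (hmemu y)).symm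
    simp_rw [h53]
    rw [← Finset.sum_div, sum_sum_filter_mem_eq P (fun S' => (0 : TV) ∈ S') (fun S' y => subTwoPoint β S' 0 y * W S')]
    congr 1
    refine sum_congr rfl fun S' _ => ?_
    unfold subSusc
    rw [Finset.mul_sum]
    exact sum_congr rfl fun y _ => mul_comm _ _
  rw [hRHS, hLHS, div_pow, le_div_iff₀ (pow_pos hZpos 2)]
  -- Cauchy–Schwarz with the weights `W ≥ 0`, `∑ W ≤ Z²`
  have hmass : ∑ S' ∈ P.filter (fun S' => (0 : TV) ∈ S'), W S' ≤ Z ^ 2 := by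
    have h1 := sum_dctW_toReal_eq (G := TG) (Λ := Finset.univ) hβ hh (hmemu 0)
    rw [div_eq_iff (pow_pos hZpos 2).ne'] at h1
    have hm : 0 ≤ isingCorr TG Finset.univ β h .free {(0 : TV)} ^ 2 := sq_nonneg _
    calc ∑ S' ∈ P.filter (fun S' => (0 : TV) ∈ S'), W S' = (1 - isingCorr TG Finset.univ β h .free {(0 : TV)} ^ 2) * Z ^ 2 := h1
      _ ≤ 1 * Z ^ 2 := mul_le_mul_of_nonneg_right (by linarith) (pow_nonneg hZpos.le 2)
      _ = Z ^ 2 := one_mul _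
  have hCS := Finset.sum_mul_sq_le_sq_mul_sq (P.filter (fun S' => (0 : TV) ∈ S'))
    (fun S' => Real.sqrt (W S')) (fun S' => Real.sqrt (W S') * subSusc β S' 0)
  have e1 : ∀ S', Real.sqrt (W S') * (Real.sqrt (W S') * subSusc β S' 0) = W S' * subSusc β S' 0 := fun S' => by
    rw [← mul_assoc, Real.mul_self_sqrt (hW0 S')]
  have e2 : ∀ S', Real.sqrt (W S') ^ 2 = W S' := fun S' => Real.sq_sqrt (hW0 S')
  have e3 : ∀ S', (Real.sqrt (W S') * subSusc β S' 0) ^ 2 = W S' * subSusc β S' 0 ^ 2 := fun S' => by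
    rw [mul_pow, Real.sq_sqrt (hW0 S')]
  simp only [e1, e2, e3] at hCS
  have hsq0 : 0 ≤ ∑ S' ∈ P.filter (fun S' => (0 : TV) ∈ S'), W S' * subSusc β S' 0 ^ 2 :=
    sum_nonneg fun S' _ => mul_nonneg (hW0 S') (sq_nonneg _)
  calc (∑ S' ∈ P.filter (fun S' => (0 : TV) ∈ S'), W S' * subSusc β S' 0) ^ 2 / (Z ^ 2) ^ 2 * Z ^ 2
      = (∑ S' ∈ P.filter (fun S' => (0 : TV) ∈ S'), W S' * subSusc β S' 0) ^ 2 / Z ^ 2 := by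
        field_simp
    _ ≤ (∑ S' ∈ P.filter (fun S' => (0 : TV) ∈ S'), W S') *
          (∑ S' ∈ P.filter (fun S' => (0 : TV) ∈ S'), W S' * subSusc β S' 0 ^ 2) / Z ^ 2 :=
        div_le_div_of_nonneg_right hCS (pow_nonneg hZpos.le 2)
    _ ≤ Z ^ 2 * (∑ S' ∈ P.filter (fun S' => (0 : TV) ∈ S'), W S' * subSusc β S' 0 ^ 2) / Z ^ 2 :=
        div_le_div_of_nonneg_right (mul_le_mul_of_nonneg_right hmass hsq0) (pow_nonneg hZpos.le 2)
    _ = ∑ S' ∈ P.filter (fun S' => (0 : TV) ∈ S'), W S' * subSusc β S' 0 ^ 2 := by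
        field_simp

end Torus

end Literature.Probability.LatticeModels
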